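import Summits.BirchSwinnertonDyer.Rank2.Chi8FloorTwistDoor
import HarnessLib

/-!
# The χ₈-floor kernel, Part D of 8 — §LatticeEngine

Planner p2 GEN 40–42 kernel `Chi8Floor` v10 (cell bsd-rank2, HOME/p2/g43/lean/Chi8Floor_v10.lean, sha bc257584; 60 theorems, `lean check` rc 0 / 0 sorry),
split into ≤400-line tree files `Rank2/Chi8Floor{Certificate,ConductorLevel,TwistDoor,LatticeEngine,TwistDoorProved,PeriodFree,TwistDoorFinal,KatoFree}`
(A–H, a linear import chain) by the lead star-p1 GEN 18 at the planner's LANDING ASK.  The mathematical overview, the honest framing (Barrier B1: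
`ord_{T=0} L₂` is the 2-adic analytic order, never `r_an`; BSD is not proved) and the references are in Part A's module docstring
(`Rank2/Chi8FloorCertificate.lean`); every theorem below carries its own `[cite: …]` tags.  Theorems only; no definition, no named fact, no instance.
[cite: MazurTateTeitelbaum1986Invent, §I.14 Proposition (p. 20)] [cite: Kato2004Asterisque, Thm. 18.4 (p. 281)] [cite: GreenbergLNM1716, §5 (p. 181)]
[cite: Stevens1989, Lemma (5.4)]
-/

noncomputable section

open PowerSeries WeierstrassCurve CongruenceSubgroup Filter
open Literature.NumberTheory.EllipticCurves Literature.NumberTheory.EllipticCurves.ModularForms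
open Literature.Barriers.BirchSwinnertonDyer

namespace Summit.BirchSwinnertonDyer.Rank2

section LatticeEngine

/-! ### The lattice engine: the QNR half-sum IS an integer in the real-lattice regime (proved)

DISCHARGE OF THE ENGINE HYPOTHESIS `hM` of `norm_twistedEighthSum_eq_one`. Write `λ(x) := {∞, x}_f ∈ ℂ`.
If `L(f,1) = {∞,0}_f = 0` then `λ(x) ∈ Λ_f` for every cusp `x` with denominator prime to `N` (Manin,
`modularSymbol_sub_zero_mem_periodLattice`). For `ε : ℤ/q → ℤ` with `ε(0) = 0` and `ε(u)` odd for `u ≠ 0`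
(the Legendre symbol) put `Z_ε := ∑_u ε(u) λ(1/8 + u/q)` and
`W := ∑_u c_u λ(1/8 + u/q) ∈ Λ_f`, `2c_u = (1 − ε(u)) − [u = 0]` (so `W = ∑_{(u/q) = −1} λ(1/8 + u/q)`).
Hecke at `q/8` (`intCast_mul_modularSymbol_div_eight`) gives the lattice identity
`2W = a_q λ(q/8) − 2λ(1/8) − Z_ε`. If `λ(1/8)`, `λ(q/8)` and `Z_ε` are REAL then `W ∈ Λ_f ∩ ℝ`; if the real
periods of `f` are the INTEGER multiples of `Ω⁺_f` (`Λ_f ∩ ℝ = ℤΩ⁺_f`: the non-rectangular lattice, one real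
component, `Δ < 0`, Cremona §2.8 — for a rectangular lattice `Λ ∩ ℝ = ℤΩ⁺/2` and the lemma is void) then
`W = kΩ⁺_f`, i.e. `∑_u c_u [1/8 + u/q]⁺_f = k ∈ ℤ`, which is `hM` (`qnrHalfSum_eq_two_mul_of_realLattice`,
`norm_qnrHalfSum_le_half_of_realLattice`). The three realness inputs are FORCED ZEROS: by Birch's formula
(`twisted_LValue_eq`) `λ(1/4) − λ(3/4) = τ·L(f⊗χ₋₄,1)` and `λ(1/8)+λ(3/8)−λ(5/8)−λ(7/8) = τ'·L(f⊗χ₋₈,1)`, and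
with Hecke at `1/4` their vanishing forces `im λ(c/8) = 0` for all odd `c`
(`im_modularSymbol_eighths_eq_zero`); for `N ≡ 1 (mod 8)`, `q ≡ 1 (mod 4)`, `χ_q(N) = +1` the four odd
twists `E^{(−1)}, E^{(−2)}, E^{(−q)}, E^{(−2q)}` have root number `−1`, whence the zeros. This PROVES the
engine law `[1/8]⁺_{f⊗χ_q}` odd ⟸ `a_q` odd ∧ `χ_q(N) = 1` in the case `N ≡ 1 (mod 8)`, `Δ(E_f) < 0`
(numerically the law holds in all cases: j326394, 2497/2497). -/

variable {N : ℕ} [NeZero N] {f : CuspForm (Gamma0 N) 2}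

/-- Reindexing `ℤ/q → Fin q` for sums of a function of the shift `u/q`, any additive codomain. [folklore] -/
theorem sum_zmod_twistShift_eq_sum_fin' {q : ℕ} [NeZero q] {M : Type*} [AddCommMonoid M] (g : ℚ → M) :
    ∑ u : ZMod q, g (twistShift u) = ∑ j : Fin q, g ((j : ℕ) / (q : ℚ)) := by
  obtain ⟨k, rfl⟩ := Nat.exists_eq_succ_of_ne_zero (NeZero.ne q)
  rfl

/-- **Hecke at the cusp `q/8`, complex form**: `a_q {∞, q/8} = ∑_{u mod q} {∞, 1/8 + u/q} + {∞, 1/8}`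
(`cuspCoeff_mul_modularSymbol` at `r = q/8`; `q·(q/8) = 1/8 + (q²−1)/8`). [cite: MazurTateTeitelbaum1986Invent, §I.4 (4.2)] -/
theorem intCast_mul_modularSymbol_div_eight (hf : IsNewform0 f)
    {q : ℕ} [NeZero q] (hq : q.Prime) (hq2 : q ≠ 2) (hqN : ¬ q ∣ N) {a : ℤ} (ha : cuspCoeff f q = a) :
    (a : ℂ) * modularSymbol f ((q : ℚ) / 8) =
      ∑ u : ZMod q, modularSymbol f (1 / 8 + twistShift u) + modularSymbol f (1 / 8) := by
  have hH := cuspCoeff_mul_modularSymbol q hf hq hqN ((q : ℚ) / 8)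
  obtain ⟨k, hk⟩ : ∃ k : ℤ, (q : ℤ) ^ 2 - 1 = 8 * k := by
    obtain ⟨t, ht⟩ := hq.odd_of_ne_two hq2
    obtain ⟨s, hs⟩ := Int.even_mul_succ_self (t : ℤ)
    refine ⟨s, ?_⟩
    have hq' : (q : ℤ) = 2 * t + 1 := by exact_mod_cast ht
    rw [hq']
    linear_combination 4 * hs
  have hqq : (q : ℚ) * ((q : ℚ) / 8) = 1 / 8 + (k : ℚ) := by
    have hk' : ((q : ℚ)) ^ 2 - 1 = 8 * (k : ℚ) := by exact_mod_cast hk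
    linear_combination hk' / 8
  have hq0 : (q : ℚ) ≠ 0 := by exact_mod_cast hq.ne_zero
  have hper : modularSymbol f ((q : ℚ) * ((q : ℚ) / 8)) = modularSymbol f (1 / 8) := by
    rw [hqq, modularSymbol_add_intCast_holds f]
  have hterm : ∀ j : Fin q, modularSymbol f ((((q : ℚ) / 8) + (j : ℕ)) / q) =
      modularSymbol f (1 / 8 + (j : ℕ) / (q : ℚ)) := by
    intro j
    congr 1
    field_simp
  rw [ha, hper, Finset.sum_congr rfl (fun j _ ↦ hterm j)] at hH
  rw [sum_zmod_twistShift_eq_sum_fin' (fun x ↦ modularSymbol f (1 / 8 + x))]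
  exact hH

omit [NeZero N] in
/-- The cusps `1/8 + u/q` have denominator dividing `8q`, prime to an odd `N` with `q ∤ N`. [folklore] -/
theorem coprime_den_eighth_add_twistShift (hN2 : ¬ 2 ∣ N) {q : ℕ} [NeZero q] (hq : q.Prime)
    (hqN : ¬ q ∣ N) (u : ZMod q) : Nat.Coprime (1 / 8 + twistShift u : ℚ).den N := by
  have hq0 : (q : ℚ) ≠ 0 := by exact_mod_cast hq.ne_zero
  have hx : (1 / 8 + twistShift u : ℚ) = ((q + 8 * u.val : ℤ) : ℚ) / ((8 * q : ℤ) : ℚ) := by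
    simp only [twistShift]
    push_cast
    field_simp
  have hden : ((1 / 8 + twistShift u : ℚ).den : ℤ) ∣ (8 * q : ℤ) := by
    rw [hx, Rat.intCast_div_eq_divInt]
    exact Rat.den_dvd _ _
  have hden' : (1 / 8 + twistShift u : ℚ).den ∣ 8 * q := by exact_mod_cast hden
  refine Nat.Coprime.coprime_dvd_left hden' ?_
  refine Nat.Coprime.mul_left ?_ ((Nat.Prime.coprime_iff_not_dvd hq).mpr hqN)
  have h2 : Nat.Coprime 2 N := (Nat.Prime.coprime_iff_not_dvd Nat.prime_two).mpr hN2
  simpa using h2.pow_left 3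

/-- **Forced zeros make the eighth symbols real.** If the `χ₋₄`- and `χ₋₈`-twisted symbol sums of `f`
vanish (`{∞,1/4} − {∞,3/4} = 0`, `{∞,1/8} + {∞,3/8} − {∞,5/8} − {∞,7/8} = 0`; by Birch's formula
`twisted_LValue_eq` these are `τ L(f⊗χ₋₄,1)` and `τ' L(f⊗χ₋₈,1)`, zero when the root numbers of
`E^{(−1)}`, `E^{(−2)}` are `−1`), then `im {∞, c/8}_f = 0` for `c = 1, 3, 5, 7` (conjugation
`{∞,−r} = conj {∞,r}`, periodicity, and Hecke at `1/4`: `a₂{∞,1/4} = {∞,1/8} + {∞,5/8} + {∞,1/2}`).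
[cite: MazurTateTeitelbaum1986Invent, §I.4 (4.2) and §I.8 (8.6)] -/
theorem im_modularSymbol_eighths_eq_zero (hf : IsNewform0 f) (hQ : coeffField f = ⊥) (hN2 : ¬ 2 ∣ N)
    (h4 : modularSymbol f (1 / 4) - modularSymbol f (3 / 4) = 0)
    (h8 : modularSymbol f (1 / 8) + modularSymbol f (3 / 8) - modularSymbol f (5 / 8)
      - modularSymbol f (7 / 8) = 0) :
    (modularSymbol f (1 / 8)).im = 0 ∧ (modularSymbol f (3 / 8)).im = 0 ∧
      (modularSymbol f (5 / 8)).im = 0 ∧ (modularSymbol f (7 / 8)).im = 0 := by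
  have hreal := cuspCoeff_im_eq_zero_of_coeffField_eq_bot hQ
  have hconj := modularSymbol_neg_eq_conj_holds f hreal
  have hper := modularSymbol_add_intCast_holds f
  -- conjugate pairs
  have h34 : modularSymbol f (3 / 4) = starRingEnd ℂ (modularSymbol f (1 / 4)) := by
    rw [← hconj, show (-(1 / 4) : ℚ) = 3 / 4 + (-1 : ℤ) by norm_num, hper]
  have h58 : modularSymbol f (5 / 8) = starRingEnd ℂ (modularSymbol f (3 / 8)) := by
    rw [← hconj, show (-(3 / 8) : ℚ) = 5 / 8 + (-1 : ℤ) by norm_num, hper]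
  have h78 : modularSymbol f (7 / 8) = starRingEnd ℂ (modularSymbol f (1 / 8)) := by
    rw [← hconj, show (-(1 / 8) : ℚ) = 7 / 8 + (-1 : ℤ) by norm_num, hper]
  have h12 : modularSymbol f (1 / 2) = starRingEnd ℂ (modularSymbol f (1 / 2)) := by
    rw [← hconj, show (-(1 / 2) : ℚ) = 1 / 2 + (-1 : ℤ) by norm_num, hper]
  -- imaginary parts
  have i14 : (modularSymbol f (1 / 4)).im = 0 := by
    have := congrArg Complex.im h4
    rw [h34, Complex.sub_im, Complex.conj_im] at this
    simp only [Complex.zero_im] at this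
    linarith
  have i12 : (modularSymbol f (1 / 2)).im = 0 := by
    have := congrArg Complex.im h12
    rw [Complex.conj_im] at this
    linarith
  have isum : (modularSymbol f (1 / 8)).im + (modularSymbol f (3 / 8)).im = 0 := by
    have := congrArg Complex.im h8
    rw [h58, h78] at this
    simp only [Complex.sub_im, Complex.add_im, Complex.conj_im, Complex.zero_im] at this
    linarith
  -- Hecke at `1/4` for `p = 2`
  have hH := cuspCoeff_mul_modularSymbol 2 hf Nat.prime_two hN2 (1 / 4)
  have hH' : cuspCoeff f 2 * modularSymbol f (1 / 4) =
      modularSymbol f (1 / 8) + modularSymbol f (5 / 8) + modularSymbol f (1 / 2) := by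
    rw [hH, Fin.sum_univ_two]
    norm_num
  have idiff : (modularSymbol f (1 / 8)).im - (modularSymbol f (3 / 8)).im = 0 := by
    have := congrArg Complex.im hH'
    rw [Complex.mul_im, hreal 2, i14, h58] at this
    simp only [mul_zero, zero_mul, add_zero, Complex.add_im, Complex.conj_im, i12] at this
    linarith
  have i18 : (modularSymbol f (1 / 8)).im = 0 := by linarith
  have i38 : (modularSymbol f (3 / 8)).im = 0 := by linarith
  refine ⟨i18, i38, ?_, ?_⟩
  · rw [h58, Complex.conj_im, i38, neg_zero]
  · rw [h78, Complex.conj_im, i18, neg_zero]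

/-- From `im {∞, c/8} = 0` (`c` odd) to `im {∞, m/8} = 0` for every odd `m` (periodicity). [folklore] -/
theorem im_modularSymbol_div_eight_eq_zero {m : ℕ} (hm : Odd m)
    (h : (modularSymbol f (1 / 8)).im = 0 ∧ (modularSymbol f (3 / 8)).im = 0 ∧
      (modularSymbol f (5 / 8)).im = 0 ∧ (modularSymbol f (7 / 8)).im = 0) :
    (modularSymbol f ((m : ℚ) / 8)).im = 0 := by
  have hper := modularSymbol_add_intCast_holds f
  have hsplit : ((m : ℚ) / 8) = ((m % 8 : ℕ) : ℚ) / 8 + ((m / 8 : ℕ) : ℤ) := by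
    have h' : ((8 * (m / 8) + m % 8 : ℕ) : ℚ) = (m : ℚ) := by exact_mod_cast Nat.div_add_mod m 8
    simp only [Int.cast_natCast]
    generalize m / 8 = d at h' ⊢
    generalize m % 8 = r at h' ⊢
    push_cast at h'
    linarith
  rw [hsplit, hper]
  obtain ⟨t, ht⟩ := hm
  have hc : m % 8 = 1 ∨ m % 8 = 3 ∨ m % 8 = 5 ∨ m % 8 = 7 := by omega
  rcases hc with hc | hc | hc | hc <;> rw [hc] <;> norm_num
  · exact h.1
  · exact h.2.1
  · exact h.2.2.1
  · exact h.2.2.2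

/-- **The lattice engine** (`hM` proved in the real-lattice regime): with `L(f,1) = 0`, `ε(0) = 0`,
`ε(u)` odd for `u ≠ 0`, `{∞,1/8}`, `{∞,q/8}` and `Z_ε = ∑_u ε(u){∞, 1/8 + u/q}` real, and every real period
of `f` an integer multiple of `Ω⁺_f` (non-rectangular `Λ_f`), the integer-coefficient combination
`∑_u (1 − ε(u))[1/8 + u/q]⁺ − [1/8]⁺ = 2·∑_{ε(u) = −1}[1/8 + u/q]⁺` is EVEN: `= 2k`, `k ∈ ℤ`.
[cite: CremonaAlgorithms1997, §2.8] [cite: MazurTateTeitelbaum1986Invent, §I.4 (4.2)] -/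
theorem qnrHalfSum_eq_two_mul_of_realLattice (hf : IsNewform0 f) (hQ : coeffField f = ⊥)
    (hN2 : ¬ 2 ∣ N) {q : ℕ} [NeZero q] (hq : q.Prime) (hq2 : q ≠ 2) (hqN : ¬ q ∣ N)
    {a : ℤ} (ha : cuspCoeff f q = a) (ε : ZMod q → ℤ) (hε0 : ε 0 = 0) (hε : ∀ u ≠ 0, Odd (ε u))
    (hL : modularSymbol f 0 = 0)
    (h18 : (modularSymbol f (1 / 8)).im = 0) (hq8 : (modularSymbol f ((q : ℚ) / 8)).im = 0)
    (hZ : (∑ u : ZMod q, (ε u : ℂ) * modularSymbol f (1 / 8 + twistShift u)).im = 0)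
    (hΛ : ∀ z ∈ periodLattice f, z.im = 0 → ∃ k : ℤ, z = k * (plusPeriod f : ℂ)) :
    ∃ k : ℤ, ∑ u : ZMod q, (1 - (ε u : ℚ)) * ratPlusSymbol f (1 / 8 + twistShift u)
        - ratPlusSymbol f (1 / 8) = 2 * k := by
  -- integer coefficients `c u` with `2 c u = (1 − ε u) − [u = 0]`
  have hc : ∀ u : ZMod q, ∃ c : ℤ, (1 - ε u) - (if u = 0 then 1 else 0) = 2 * c := by
    intro u
    by_cases hu : u = 0
    · exact ⟨0, by simp [hu, hε0]⟩
    · obtain ⟨m, hm⟩ := hε u hu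
      exact ⟨-m, by rw [if_neg hu, hm]; ring⟩
  choose c hc using hc
  have hx0 : (1 / 8 + twistShift (0 : ZMod q) : ℚ) = 1 / 8 := by simp [twistShift]
  -- Hecke at `q/8`
  have hHecke := intCast_mul_modularSymbol_div_eight hf hq hq2 hqN ha
  -- lattice membership of every `{∞, 1/8 + u/q}`
  have hmem : ∀ u : ZMod q, modularSymbol f (1 / 8 + twistShift u) ∈ periodLattice f := by
    intro u
    have h := modularSymbol_sub_zero_mem_periodLattice f (coprime_den_eighth_add_twistShift hN2 hq hqN u)
    rwa [hL, sub_zero] at h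
  -- the lattice vector `W`
  set W : ℂ := ∑ u : ZMod q, (c u : ℂ) * modularSymbol f (1 / 8 + twistShift u) with hW
  have hWmem : W ∈ periodLattice f := by
    refine sum_mem fun u _ ↦ ?_
    rw [← zsmul_eq_mul]
    exact AddSubgroup.zsmul_mem _ (hmem u) _
  -- `2W = a{∞,q/8} − 2{∞,1/8} − Z`
  have hsum0 : ∑ u : ZMod q, (if u = 0 then modularSymbol f (1 / 8 + twistShift u) else 0) =
      modularSymbol f (1 / 8) := by
    rw [Finset.sum_ite_eq' Finset.univ (0 : ZMod q) (fun u ↦ modularSymbol f (1 / 8 + twistShift u)),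
      if_pos (Finset.mem_univ _), hx0]
  have h2W : 2 * W = (a : ℂ) * modularSymbol f ((q : ℚ) / 8) - 2 * modularSymbol f (1 / 8)
      - ∑ u : ZMod q, (ε u : ℂ) * modularSymbol f (1 / 8 + twistShift u) := by
    have hterm : ∀ u : ZMod q, (2 : ℂ) * ((c u : ℂ) * modularSymbol f (1 / 8 + twistShift u)) =
        (modularSymbol f (1 / 8 + twistShift u) - (ε u : ℂ) * modularSymbol f (1 / 8 + twistShift u))
          - (if u = 0 then modularSymbol f (1 / 8 + twistShift u) else 0) := by
      intro u
      have hcu : (2 : ℂ) * (c u : ℂ) = (1 - (ε u : ℂ)) - (if u = 0 then 1 else 0) := by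
        have := hc u
        split_ifs with hu
        · rw [if_pos hu] at this
          exact_mod_cast this.symm
        · rw [if_neg hu] at this
          exact_mod_cast this.symm
      rw [← mul_assoc, hcu]
      split_ifs <;> ring
    rw [hW, Finset.mul_sum, Finset.sum_congr rfl (fun u _ ↦ hterm u), Finset.sum_sub_distrib,
      Finset.sum_sub_distrib, hsum0]
    linear_combination -hHecke
  -- `W` is real, hence an integer multiple of `Ω⁺`
  have hWim : W.im = 0 := by
    have h := congrArg Complex.im h2W
    simp only [Complex.mul_im, Complex.sub_im, hq8, h18, hZ, Complex.intCast_re, Complex.intCast_im,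
      Complex.re_ofNat, Complex.im_ofNat, mul_zero, zero_mul, add_zero, sub_zero] at h
    linarith
  obtain ⟨k, hk⟩ := hΛ W hWmem hWim
  -- real parts: `re {∞, x_u} = [x_u]⁺ Ω⁺`
  have hreal := cuspCoeff_im_eq_zero_of_coeffField_eq_bot hQ
  have hΩ : 0 < plusPeriod f := IsNewform0.plusPeriod_pos_holds hf hQ
  have hre : ∀ u : ZMod q, (modularSymbol f (1 / 8 + twistShift u)).re =
      ((ratPlusSymbol f (1 / 8 + twistShift u) : ℚ) : ℝ) * plusPeriod f := by
    intro u
    have h := ratCast_ratPlusSymbol_mul_plusPeriod f hf hQ (1 / 8 + twistShift u)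
    rw [plusSymbol_eq_re_holds f hreal] at h
    have h' := congrArg Complex.re h
    simp only [Complex.mul_re, Complex.ofReal_re, Complex.ofReal_im, Complex.ratCast_re,
      Complex.ratCast_im, mul_zero, sub_zero] at h'
    exact h'.symm
  have hWre : W.re = (∑ u : ZMod q, (c u : ℝ) * ((ratPlusSymbol f (1 / 8 + twistShift u) : ℚ) : ℝ))
      * plusPeriod f := by
    rw [hW, Complex.re_sum, Finset.sum_mul]
    refine Finset.sum_congr rfl fun u _ ↦ ?_
    rw [Complex.mul_re, Complex.intCast_re, Complex.intCast_im, zero_mul, sub_zero, hre u, mul_assoc]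
  have hkre : W.re = (k : ℝ) * plusPeriod f := by
    rw [hk]
    simp [Complex.mul_re]
  have hkey : ∑ u : ZMod q, (c u : ℝ) * ((ratPlusSymbol f (1 / 8 + twistShift u) : ℚ) : ℝ) = (k : ℝ) :=
    mul_right_cancel₀ hΩ.ne' (hWre.symm.trans hkre)
  have hkeyQ : ∑ u : ZMod q, (c u : ℚ) * ratPlusSymbol f (1 / 8 + twistShift u) = (k : ℚ) := by
    exact_mod_cast hkey
  refine ⟨k, ?_⟩
  -- `∑ (1 − ε u)[x u] − [x 0] = ∑ (2 c u + [u=0]) [x u] − [x 0] = 2 ∑ c u [x u]`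
  have hcoef : ∀ u : ZMod q, (1 - (ε u : ℚ)) = 2 * (c u : ℚ) + (if u = 0 then 1 else 0) := by
    intro u
    have := hc u
    split_ifs with hu
    · rw [if_pos hu] at this
      have h' : ((1 - ε u : ℤ) : ℚ) - 1 = 2 * (c u : ℚ) := by exact_mod_cast this
      push_cast at h'
      linarith
    · rw [if_neg hu] at this
      have h' : ((1 - ε u : ℤ) : ℚ) - 0 = 2 * (c u : ℚ) := by exact_mod_cast this
      push_cast at h'
      linarith
  have hsum0' : ∑ u : ZMod q, (if u = 0 then ratPlusSymbol f (1 / 8 + twistShift u) else 0) =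
      ratPlusSymbol f (1 / 8) := by
    rw [Finset.sum_ite_eq' Finset.univ (0 : ZMod q) (fun u ↦ ratPlusSymbol f (1 / 8 + twistShift u)),
      if_pos (Finset.mem_univ _), hx0]
  have hterm : ∀ u : ZMod q, (1 - (ε u : ℚ)) * ratPlusSymbol f (1 / 8 + twistShift u) =
      2 * ((c u : ℚ) * ratPlusSymbol f (1 / 8 + twistShift u))
        + (if u = 0 then ratPlusSymbol f (1 / 8 + twistShift u) else 0) := by
    intro u
    rw [hcoef u]
    split_ifs <;> ring
  rw [Finset.sum_congr rfl (fun u _ ↦ hterm u), Finset.sum_add_distrib, ← Finset.mul_sum, hsum0', hkeyQ]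
  ring

/-- **`hM` discharged**: in the real-lattice regime the QNR half-sum term has `2`-adic norm `≤ 1/2`.
[cite: CremonaAlgorithms1997, §2.8] -/
theorem norm_qnrHalfSum_le_half_of_realLattice (hf : IsNewform0 f) (hQ : coeffField f = ⊥)
    (hN2 : ¬ 2 ∣ N) {q : ℕ} [NeZero q] (hq : q.Prime) (hq2 : q ≠ 2) (hqN : ¬ q ∣ N)
    {a : ℤ} (ha : cuspCoeff f q = a) (ε : ZMod q → ℤ) (hε0 : ε 0 = 0) (hε : ∀ u ≠ 0, Odd (ε u))
    (hL : modularSymbol f 0 = 0)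
    (h18 : (modularSymbol f (1 / 8)).im = 0) (hq8 : (modularSymbol f ((q : ℚ) / 8)).im = 0)
    (hZ : (∑ u : ZMod q, (ε u : ℂ) * modularSymbol f (1 / 8 + twistShift u)).im = 0)
    (hΛ : ∀ z ∈ periodLattice f, z.im = 0 → ∃ k : ℤ, z = k * (plusPeriod f : ℂ)) :
    ‖((∑ u : ZMod q, (1 - (ε u : ℚ)) * ratPlusSymbol f (1 / 8 + twistShift u)
        - ratPlusSymbol f (1 / 8) : ℚ) : ℚ_[2])‖ ≤ 2⁻¹ := by
  obtain ⟨k, hk⟩ := qnrHalfSum_eq_two_mul_of_realLattice hf hQ hN2 hq hq2 hqN ha ε hε0 hε hL h18 hq8 hZ hΛ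
  rw [hk]
  push_cast
  rw [norm_mul, show ((2 : ℚ_[2])) = ((2 : ℕ) : ℚ_[2]) by norm_cast, Padic.norm_p]
  push_cast
  calc (2 : ℝ)⁻¹ * ‖(k : ℚ_[2])‖ ≤ 2⁻¹ * 1 := by gcongr; exact Padic.norm_int_le_one k
    _ = 2⁻¹ := by ring

/-- **The engine law, proved case** (`N` odd, real-lattice regime): `a_q` odd, `[q/8]⁺` a `2`-adic unit,
`[1/8]⁺ ∈ ℤ₍₂₎`, forced zeros (realness) and non-rectangular `Λ_f` ⇒ the twisted eighth sum
`∑_u ε(u)[1/8 + u/q]⁺_f` is a `2`-adic unit. [cite: MazurTateTeitelbaum1986Invent, §I.4 (4.2) and §I.8] -/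
theorem norm_twistedEighthSum_eq_one_of_realLattice (hf : IsNewform0 f) (hQ : coeffField f = ⊥)
    (hN2 : ¬ 2 ∣ N) {q : ℕ} [NeZero q] (hq : q.Prime) (hq2 : q ≠ 2) (hqN : ¬ q ∣ N)
    {a : ℤ} (ha : cuspCoeff f q = a) (hodd : Odd a) (ε : ZMod q → ℤ) (hε0 : ε 0 = 0)
    (hε : ∀ u ≠ 0, Odd (ε u)) (hL : modularSymbol f 0 = 0)
    (h18 : (modularSymbol f (1 / 8)).im = 0) (hq8 : (modularSymbol f ((q : ℚ) / 8)).im = 0)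
    (hZ : (∑ u : ZMod q, (ε u : ℂ) * modularSymbol f (1 / 8 + twistShift u)).im = 0)
    (hΛ : ∀ z ∈ periodLattice f, z.im = 0 → ∃ k : ℤ, z = k * (plusPeriod f : ℂ))
    (h8q : ‖((ratPlusSymbol f ((q : ℚ) / 8) : ℚ) : ℚ_[2])‖ = 1)
    (h8 : ‖((ratPlusSymbol f (1 / 8) : ℚ) : ℚ_[2])‖ ≤ 1) :
    ‖((∑ u : ZMod q, (ε u : ℚ) * ratPlusSymbol f (1 / 8 + twistShift u) : ℚ) : ℚ_[2])‖ = 1 :=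
  norm_twistedEighthSum_eq_one hf hQ hq hq2 hqN ha hodd ε h8q h8
    (norm_qnrHalfSum_le_half_of_realLattice hf hQ hN2 hq hq2 hqN ha ε hε0 hε hL h18 hq8 hZ hΛ)

end LatticeEngine

end Summit.BirchSwinnertonDyer.Rank2

end
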